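import Literature.Analysis.FluidPDE.DivCurlLpEstimate
import HarnessLib

/-!
# One row of the velocity gradient is controlled in `L^p` by two components of the vorticity

search for candidate a priori estimates; no regularity claim (cell `pub-nsfunc`, literature seat:
a published estimate as THEOREMS; nothing new).

The structural input of Chae–Choe's two-vorticity-components regularity criterion (Chae–Choe,
Electron. J. Differential Equations 1999 No. 05, proof of Thm. 1, (7)–(8): in the Biot–Savart
representation of `(ω·∇)v·ω` the interaction of the third components alone vanishes, and the
singular integrals `P(ω̃)` of the two other components `ω̃ = ω₁e₁ + ω₂e₂` are bounded in `L^γ`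
by the Calderón–Zygmund inequality) and of Cao–Titi's one-entry criterion: for a
divergence-free field `u` on `ℝ³`, `Δu_k = −(curl ω)_k = ∂_{k+2} ω_{k+1} − ∂_{k+1} ω_{k+2}`
involves only the two components `ω_{k+1}, ω_{k+2}` of `ω = curl u` (indices mod `3`), hence the
whole row `∇u_k` is a Calderón–Zygmund image of those two components:

* `exists_eLpNorm_fderiv_apply_le_curl_apply_add_divergence` — test fields:
  `‖∂ᵥu_k‖_{L^p} ≤ C (‖(curl u)_{k+1}‖_{L^p} + ‖(curl u)_{k+2}‖_{L^p} + ‖div u‖_{L^p})` for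
  `u ∈ C^∞_c(ℝ³; ℝ³)`, `|v| ≤ 1`, `1 < p < ∞` (the Helmholtz decomposition
  `∂ᵥu_k = (∂ᵥ K₃ ∗ curl u)_k + N[∂ᵥ∂_k div u]`, tree `fderiv_apply_eq_fderiv_biotSavart_curl_add`,
  the componentwise Calderón–Zygmund bound `exists_eLpNorm_fderiv_biotSavart_apply_le`
  (Majda–Bertozzi §4.2, (11.9); Beirão da Veiga–Berselli (4.2)) and the bound for
  `N[∂ᵥ∂_k ρ]`);
* `exists_eLpNorm_fderiv_apply_le_curl_apply_of_isDivFree_of_eLpNorm_lt_top` — smooth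
  divergence-free fields with an `L^s` tail (`1 < p ≤ s < ∞`, `3(1/p − 1/s) < 1`):
  `‖∂ᵥu_k‖_{L^p} ≤ C (‖ω_{k+1}‖_{L^p} + ‖ω_{k+2}‖_{L^p})`, by the truncation-and-Fatou argument of
  the tree's `exists_eLpNorm_fderiv_le_curl_of_isDivFree_of_eLpNorm_lt_top` (Majda–Bertozzi
  (11.9)) run on one entry.

## Mathlib / tree search

Tree: `fderiv_apply_eq_fderiv_biotSavart_curl_add`,
`exists_eLpNorm_fderiv_le_curl_of_isDivFree_of_eLpNorm_lt_top` (`DivCurlLpEstimate`),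
`exists_eLpNorm_fderiv_biotSavart_apply_le` (`BiotSavartGradientLp`),
`exists_eLpNorm_convolution_mixed_fderiv2_newtonKernel_le` (`NewtonPotentialCZTest`), `cutoff`,
`exists_norm_fderiv_cutoff_le`, `tendsto_cutoff_natCast_add_one`, `fderiv_cutoff_eq_zero_of_gt`,
`divergence_smul_apply` (`WholeSpaceIBP`), `curl_smul` (`VorticityCalculus`). Mathlib:
`MeasureTheory.Lp.eLpNorm_lim_le_liminf_eLpNorm`, `eLpNorm_le_eLpNorm_mul_rpow_measure_univ`.

## References

* D. Chae, H.-J. Choe, *Regularity of solutions to the Navier–Stokes equation*, Electron. J.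
  Differential Equations 1999 (1999), No. 05, 1–7: proof of Thm. 1, (7)–(9) (open access; text
  read). [ChaeChoe1999]
* A. J. Majda, A. L. Bertozzi, *Vorticity and incompressible flow* (2002), §2.4.1
  (2.92)–(2.96), §4.2 (p. 144 of the held text), Prop. 10.6, (11.9). [MajdaBertozziCUP2002]
-/

noncomputable section

open MeasureTheory Set Filter Topology Function Metric ContinuousLinearMap
open scoped ENNReal NNReal Convolution ContDiff RealInnerProductSpace

namespace Literature.Analysis.FluidPDE

section RowEstimate

-- nested operator types (`curlCLM : (ℝ³ →L ℝ³) →L ℝ³`)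
set_option maxSynthPendingDepth 3

variable {u : EuclideanSpace ℝ (Fin 3) → EuclideanSpace ℝ (Fin 3)}

/-- The curl of a `C^∞` field is `C^∞`. [folklore] -/
private theorem contDiff_curl_infty_row (hu : ContDiff ℝ ∞ u) : ContDiff ℝ ∞ (curl u) :=
  contDiff_curl (n := ⊤) (hu.of_le (by exact_mod_cast le_top))

/-- The divergence of a `C^∞` field is `C^∞`. [folklore] -/
private theorem contDiff_divergence_infty_row (hu : ContDiff ℝ ∞ u) :
    ContDiff ℝ ∞ (VectorCalculus.divergence u) :=
  contDiff_divergence (n := ⊤) (hu.of_le (by exact_mod_cast le_top))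

/-- The divergence of a compactly supported field is compactly supported. [folklore] -/
private theorem hasCompactSupport_divergence_of_row (huc : HasCompactSupport u) :
    HasCompactSupport (VectorCalculus.divergence u) :=
  huc.mono' fun x hx => by
    contrapose! hx
    simp only [mem_support, not_not]
    exact divergence_eq_zero_of_notMem_tsupport hx

/-- A component of a `C^∞` field is `C^∞` with the support of the field. [folklore] -/
private theorem contDiff_apply_infty_row (hu : ContDiff ℝ ∞ u) (j : Fin 3) :
    ContDiff ℝ ∞ fun x => u x j :=
  contDiff_apply_coord hu j

/-- **The `L^p` row estimate for test fields.** For `1 < p < ∞` there is `C = C(p)` such that for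
every `u ∈ C^∞_c(ℝ³; ℝ³)`, every `|v| ≤ 1` and every index `k`,
`‖∂ᵥu_k‖_{L^p} ≤ C (‖(curl u)_{k+1}‖_{L^p} + ‖(curl u)_{k+2}‖_{L^p} + ‖div u‖_{L^p})` (indices
mod `3`): the Helmholtz decomposition `∂ᵥu_k = (∂ᵥ K₃ ∗ curl u)_k + N[∂ᵥ∂_k div u]` and the
Calderón–Zygmund bounds for the two singular integrals, the first of which sees only the
components `k+1, k+2` of `curl u` (`(K₃ ∗ ω)_k = −Γ ∗ (curl ω)_k`; Chae–Choe (7): the third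
components do not interact). [cite: ChaeChoe1999, proof of Thm. 1, (7)–(8); MajdaBertozziCUP2002, §4.2 display before Lemma 4.6 (p. 144 of the held text) with §2.4.1 (2.92)–(2.96)] -/
theorem exists_eLpNorm_fderiv_apply_le_curl_apply_add_divergence {p : ℝ≥0∞} (hp1 : 1 < p)
    (hp2 : p < ⊤) :
    ∃ C : ℝ≥0, ∀ u : EuclideanSpace ℝ (Fin 3) → EuclideanSpace ℝ (Fin 3), ContDiff ℝ ∞ u →
      HasCompactSupport u → ∀ v : EuclideanSpace ℝ (Fin 3), ‖v‖ ≤ 1 → ∀ k : Fin 3,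
        eLpNorm (fun x => fderiv ℝ u x v k) p volume ≤
          C * (eLpNorm (fun x => curl u x (k + 1)) p volume +
            eLpNorm (fun x => curl u x (k + 2)) p volume +
            eLpNorm (VectorCalculus.divergence u) p volume) := by
  obtain ⟨C₁, hC₁⟩ := exists_eLpNorm_fderiv_biotSavart_apply_le hp1 hp2
  obtain ⟨C₂, hC₂⟩ := exists_eLpNorm_convolution_mixed_fderiv2_newtonKernel_le hp1 hp2
  refine ⟨max C₁ C₂, fun u hu huc v hv k => ?_⟩
  have hp1' : 1 ≤ p := hp1.le
  have hsingle : ‖(EuclideanSpace.single k (1 : ℝ) : EuclideanSpace ℝ (Fin 3))‖ ≤ 1 := by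
    rw [PiLp.norm_single, norm_one]
  set d : EuclideanSpace ℝ (Fin 3) → ℝ := VectorCalculus.divergence u with hd
  have hdi : ContDiff ℝ ∞ d := contDiff_divergence_infty_row hu
  have hdc : HasCompactSupport d := hasCompactSupport_divergence_of_row huc
  -- the two pieces
  set f : EuclideanSpace ℝ (Fin 3) → ℝ := fun x => fderiv ℝ (biotSavart (curl u)) x v k with hf
  set g : EuclideanSpace ℝ (Fin 3) → ℝ := (fun t => fderiv ℝ (fun s => fderiv ℝ d s
    (EuclideanSpace.single k 1)) t v) ⋆[lsmul ℝ ℝ, volume] newtonKernel with hg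
  have e : (fun x => fderiv ℝ u x v k) = fun x => f x + g x :=
    funext fun x => fderiv_apply_eq_fderiv_biotSavart_curl_add hu huc x v k
  have hgm : AEStronglyMeasurable g volume :=
    (contDiff_convolution_newtonKernel (contDiff_fderiv_fderiv_apply hdi _ _)
      (hasCompactSupport_fderiv_fderiv_apply hdc _ _)).continuous.aestronglyMeasurable
  have hDum : Continuous fun x => fderiv ℝ u x v k :=
    (EuclideanSpace.proj k).continuous.comp
      ((hu.continuous_fderiv (by simp)).clm_apply continuous_const)
  have hfm : AEStronglyMeasurable f volume := by
    have ef : f = fun x => fderiv ℝ u x v k - g x := by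
      funext x
      have := congrFun e x
      simp only at this
      rw [this]
      ring
    rw [ef]
    exact hDum.aestronglyMeasurable.sub hgm
  have hbf : eLpNorm f p volume ≤
      C₁ * (eLpNorm (fun x => curl u x (k + 1)) p volume +
        eLpNorm (fun x => curl u x (k + 2)) p volume) :=
    hC₁ (curl u) (contDiff_curl_infty_row hu) (hasCompactSupport_curl huc) v hv k
  have hbg : eLpNorm g p volume ≤ C₂ * eLpNorm d p volume := hC₂ _ v hsingle hv d hdi hdc
  rw [e]
  set S₁ := eLpNorm (fun x => curl u x (k + 1)) p volume + eLpNorm (fun x => curl u x (k + 2)) p volume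
  calc eLpNorm (fun x => f x + g x) p volume
      ≤ eLpNorm f p volume + eLpNorm g p volume := eLpNorm_add_le hfm hgm hp1'
    _ ≤ C₁ * S₁ + C₂ * eLpNorm d p volume := add_le_add hbf hbg
    _ ≤ (max C₁ C₂ : ℝ≥0) * S₁ + (max C₁ C₂ : ℝ≥0) * eLpNorm d p volume := by
        gcongr
        · exact_mod_cast le_max_left C₁ C₂
        · exact_mod_cast le_max_right C₁ C₂
    _ = (max C₁ C₂ : ℝ≥0) * (S₁ + eLpNorm d p volume) := (mul_add _ _ _).symm

/-- An `L^p` triangle inequality with a scalar weight: if `‖f‖ ≤ ‖g‖ + c‖h‖` pointwise with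
`c ≥ 0`, then `‖f‖_{L^p} ≤ ‖g‖_{L^p} + c‖h‖_{L^p}`. [folklore] -/
private theorem eLpNorm_le_of_norm_le_add_mul_row {X : Type*} [MeasurableSpace X] {μ : Measure X}
    {F G H : Type*} [NormedAddCommGroup F] [NormedAddCommGroup G] [NormedAddCommGroup H]
    {f : X → F} {g : X → G} {h : X → H} {c : ℝ} (hc : 0 ≤ c)
    (hg : AEStronglyMeasurable g μ) (hh : AEStronglyMeasurable h μ) {p : ℝ≥0∞} (hp : 1 ≤ p)
    (hle : ∀ x, ‖f x‖ ≤ ‖g x‖ + c * ‖h x‖) :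
    eLpNorm f p μ ≤ eLpNorm g p μ + ENNReal.ofReal c * eLpNorm h p μ := by
  calc eLpNorm f p μ ≤ eLpNorm ((fun x => ‖g x‖) + fun x => c * ‖h x‖) p μ :=
        eLpNorm_mono_real fun x => by simpa only [Pi.add_apply] using hle x
    _ ≤ eLpNorm (fun x => ‖g x‖) p μ + eLpNorm (fun x => c * ‖h x‖) p μ :=
        eLpNorm_add_le hg.norm (hh.norm.const_mul c) hp
    _ = eLpNorm g p μ + ENNReal.ofReal c * eLpNorm h p μ := by
        rw [eLpNorm_norm, show (fun x => c * ‖h x‖) = c • fun x => ‖h x‖ from rfl,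
          eLpNorm_const_smul, eLpNorm_norm, Real.enorm_eq_ofReal hc]

/-- The norm of the gradient is the norm of the derivative. [folklore] -/
private theorem norm_gradient_eq_row {f : EuclideanSpace ℝ (Fin 3) → ℝ}
    (x : EuclideanSpace ℝ (Fin 3)) : ‖gradient f x‖ = ‖fderiv ℝ f x‖ := by
  unfold gradient
  exact (InnerProductSpace.toDual ℝ (EuclideanSpace ℝ (Fin 3))).symm.norm_map _

/-- A component is bounded by the vector: `|y k| ≤ ‖y‖`. [folklore] -/
private theorem abs_apply_le_norm_row (y : EuclideanSpace ℝ (Fin 3)) (k : Fin 3) : |y k| ≤ ‖y‖ := by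
  have h := EuclideanSpace.norm_sq_eq y
  have hk : |y k| ^ 2 ≤ ∑ j, |y j| ^ 2 :=
    Finset.single_le_sum (f := fun j => |y j| ^ 2) (fun j _ => sq_nonneg _) (Finset.mem_univ k)
  have h2 : |y k| ^ 2 ≤ ‖y‖ ^ 2 := by
    rw [h]
    simpa only [Real.norm_eq_abs] using hk
  exact abs_le_of_sq_le_sq' (by nlinarith [norm_nonneg y, abs_nonneg (y k)]) (norm_nonneg _) |>.2

/-- **`‖∂ᵥu_k‖_{L^p} ≤ C_p (‖ω_{k+1}‖_{L^p} + ‖ω_{k+2}‖_{L^p})` for smooth divergence-free fields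
with an `L^s` tail** (`1 < p ≤ s < ∞`, `3(1/p − 1/s) < 1`; indices mod `3`): there is
`C = C(p)` such that every `u ∈ C^∞(ℝ³; ℝ³)` with `div u = 0` and `‖u‖_{L^s} < ∞` satisfies, for
all `|v| ≤ 1` and `k`, `‖∂ᵥu_k‖_{L^p(ℝ³)} ≤ C (‖ω_{k+1}‖_{L^p} + ‖ω_{k+2}‖_{L^p})`, `ω = curl u`
— the row `∇u_k` of the velocity gradient is a Calderón–Zygmund image of the two other vorticity
components (`Δu_k = ∂_{k+2}ω_{k+1} − ∂_{k+1}ω_{k+2}`; Chae–Choe: "`P(ω̃)` denotes the singular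
integral operator … we used the Calderón–Zygmund inequality"). Proof: the test-field row
estimate for the truncations `χ(·/(n+1)) u` and Fatou's lemma in `L^p`, verbatim the tree's
`exists_eLpNorm_fderiv_le_curl_of_isDivFree_of_eLpNorm_lt_top` on one entry. [cite: ChaeChoe1999, proof of Thm. 1, (7)–(9); MajdaBertozziCUP2002, Ch. 11 (11.9) (p. 367 of the held text) with Prop. 10.6 (p. 359)] -/
theorem exists_eLpNorm_fderiv_apply_le_curl_apply_of_isDivFree_of_eLpNorm_lt_top {p s : ℝ≥0∞}
    (hp1 : 1 < p) (hps : p ≤ s) (hs : s < ⊤) (hgap : 3 * (1 / p.toReal - 1 / s.toReal) < 1) :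
    ∃ C : ℝ≥0, ∀ u : EuclideanSpace ℝ (Fin 3) → EuclideanSpace ℝ (Fin 3), ContDiff ℝ ∞ u →
      VectorCalculus.IsDivFree u → eLpNorm u s volume < ⊤ →
        ∀ v : EuclideanSpace ℝ (Fin 3), ‖v‖ ≤ 1 → ∀ k : Fin 3,
          eLpNorm (fun x => fderiv ℝ u x v k) p volume ≤
            C * (eLpNorm (fun x => curl u x (k + 1)) p volume +
              eLpNorm (fun x => curl u x (k + 2)) p volume) := by
  have hp2 : p < ⊤ := lt_of_le_of_lt hps hs
  obtain ⟨C, hC⟩ := exists_eLpNorm_fderiv_apply_le_curl_apply_add_divergence hp1 hp2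
  obtain ⟨C₁, hC₁0, hC₁⟩ := exists_norm_fderiv_cutoff_le (E := EuclideanSpace ℝ (Fin 3))
  refine ⟨C, fun u hu hdiv hus v hv k => ?_⟩
  have hp1' : 1 ≤ p := hp1.le
  have hud : Differentiable ℝ u := hu.differentiable (by simp)
  have huc : Continuous u := hu.continuous
  have hDuc : Continuous (fderiv ℝ u) := hu.continuous_fderiv (by simp)
  have hcurlc : Continuous (curl u) := continuous_curl (hu.of_le one_le_infty)
  have hcurljc : ∀ j, Continuous fun x => curl u x j := fun j =>
    (EuclideanSpace.proj j).continuous.comp hcurlc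
  have hentry : Continuous fun x => fderiv ℝ u x v k :=
    (EuclideanSpace.proj k).continuous.comp (hDuc.clm_apply continuous_const)
  -- the Hölder exponent gap `e = 1/p - 1/s ≥ 0`, `3e < 1`
  set e : ℝ := 1 / p.toReal - 1 / s.toReal with hedef
  have hp0r : 0 < p.toReal := ENNReal.toReal_pos (lt_trans zero_lt_one hp1).ne' hp2.ne
  have he0 : 0 ≤ e := by
    rw [hedef, sub_nonneg]
    exact one_div_le_one_div_of_le hp0r (ENNReal.toReal_mono hs.ne hps)
  -- the truncations `wₙ = χ(·/(n+1)) u`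
  set R : ℕ → ℝ := fun n => (n : ℝ) + 1 with hRdef
  have hR : ∀ n, 0 < R n := fun n => by positivity
  set χ : ℕ → EuclideanSpace ℝ (Fin 3) → ℝ := fun n => cutoff (R n) with hχ
  have hχd : ∀ n, ContDiff ℝ ∞ (χ n) := fun n => contDiff_cutoff _
  have hχdiff : ∀ n x, DifferentiableAt ℝ (χ n) x := fun n x =>
    (hχd n).differentiable (by simp) x
  have hχc : ∀ n, HasCompactSupport (χ n) := fun n => hasCompactSupport_cutoff (hR n)
  have hχ1 : ∀ n x, |χ n x| ≤ 1 := fun n x => abs_cutoff_le_one _ _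
  have hDχ : ∀ n x, ‖fderiv ℝ (χ n) x‖ ≤ C₁ / R n := fun n x => hC₁ (R n) (hR n) x
  set w : ℕ → EuclideanSpace ℝ (Fin 3) → EuclideanSpace ℝ (Fin 3) := fun n x => χ n x • u x
    with hw
  have hwd : ∀ n, ContDiff ℝ ∞ (w n) := fun n => (hχd n).smul hu
  have hwc : ∀ n, HasCompactSupport (w n) := fun n => (hχc n).smul_right
  -- the balls carrying `∇χₙ` and the localised field `Uₙ = 1_{B̄(0,2Rₙ)} u`
  set B : ℕ → Set (EuclideanSpace ℝ (Fin 3)) := fun n => closedBall 0 (2 * R n) with hB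
  set U : ℕ → EuclideanSpace ℝ (Fin 3) → EuclideanSpace ℝ (Fin 3) := fun n => (B n).indicator u
    with hUdef
  have mU : ∀ n, AEStronglyMeasurable (U n) volume := fun n =>
    huc.aestronglyMeasurable.indicator measurableSet_closedBall
  have hT : ∀ n x, ‖(fderiv ℝ (χ n) x).smulRight (u x)‖ ≤ C₁ / R n * ‖U n x‖ := by
    intro n x
    rw [norm_smulRight_apply]
    by_cases hx : x ∈ B n
    · rw [hUdef]; dsimp only; rw [indicator_of_mem hx]
      exact mul_le_mul_of_nonneg_right (hDχ n x) (norm_nonneg _)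
    · have hx' : 2 * R n < ‖x‖ := by
        rw [hB] at hx
        simpa [mem_closedBall, dist_zero_right] using hx
      rw [show fderiv ℝ (χ n) x = 0 from fderiv_cutoff_eq_zero_of_gt (hR n) hx', norm_zero,
        zero_mul]
      positivity
  -- volume of the balls and the Hölder bound `‖Uₙ‖_p ≤ ‖u‖_s |Bₙ|^e`
  set v₁ : ℝ≥0∞ := volume (ball (0 : EuclideanSpace ℝ (Fin 3)) 1) with hv₁
  have hv₁t : v₁ < ⊤ := measure_ball_lt_top
  have hvolB : ∀ n, volume (B n) = ENNReal.ofReal ((2 * R n) ^ 3) * v₁ := fun n => by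
    have h := Measure.addHaar_closedBall (volume : Measure (EuclideanSpace ℝ (Fin 3)))
      (0 : EuclideanSpace ℝ (Fin 3)) (by positivity : 0 ≤ 2 * R n)
    rw [finrank_euclideanSpace_fin] at h
    exact h
  set M : ℝ≥0∞ := v₁ ^ e * eLpNorm u s volume with hM
  have hMt : M < ⊤ := ENNReal.mul_lt_top (ENNReal.rpow_lt_top_of_nonneg he0 hv₁t.ne) hus
  set δ : ℕ → ℝ := fun n => C₁ / R n * ((2 * R n) ^ 3) ^ e with hδ
  have hδ0 : ∀ n, 0 ≤ δ n := fun n => by positivity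
  have hUp : ∀ n, eLpNorm (U n) p volume ≤ ENNReal.ofReal (((2 * R n) ^ 3) ^ e) * M := by
    intro n
    have h1 : eLpNorm (U n) p volume = eLpNorm u p (volume.restrict (B n)) := by
      rw [hUdef]; dsimp only
      rw [eLpNorm_indicator_eq_eLpNorm_restrict measurableSet_closedBall]
    rw [h1]
    calc eLpNorm u p (volume.restrict (B n))
        ≤ eLpNorm u s (volume.restrict (B n)) *
            (volume.restrict (B n)) univ ^ (1 / p.toReal - 1 / s.toReal) :=
          eLpNorm_le_eLpNorm_mul_rpow_measure_univ hps huc.aestronglyMeasurable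
      _ ≤ eLpNorm u s volume * (volume (B n)) ^ e := by
          rw [Measure.restrict_apply_univ, ← hedef]
          exact mul_le_mul' (eLpNorm_mono_measure u Measure.restrict_le_self) le_rfl
      _ = ENNReal.ofReal (((2 * R n) ^ 3) ^ e) * M := by
          rw [hvolB, ENNReal.mul_rpow_of_nonneg _ _ he0,
            ENNReal.ofReal_rpow_of_nonneg (by positivity) he0, hM]
          ring
  have hQ : ∀ n, ENNReal.ofReal (C₁ / R n) * eLpNorm (U n) p volume ≤ ENNReal.ofReal (δ n) * M := by
    intro n
    calc ENNReal.ofReal (C₁ / R n) * eLpNorm (U n) p volume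
        ≤ ENNReal.ofReal (C₁ / R n) * (ENNReal.ofReal (((2 * R n) ^ 3) ^ e) * M) :=
          mul_le_mul' le_rfl (hUp n)
      _ = ENNReal.ofReal (δ n) * M := by
          rw [← mul_assoc, ← ENNReal.ofReal_mul (div_nonneg hC₁0 (hR n).le)]
  -- the error terms
  set ε : ℕ → ℝ≥0∞ := fun n =>
    ((C : ℝ≥0∞) * (ENNReal.ofReal ‖curlCLM‖ + ENNReal.ofReal ‖curlCLM‖ + 1) + 1) *
      (ENNReal.ofReal (δ n) * M) with hε
  set S₁ : ℝ≥0∞ := eLpNorm (fun x => curl u x (k + 1)) p volume +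
    eLpNorm (fun x => curl u x (k + 2)) p volume with hS₁
  -- Step 1: `‖χₙ ∂ᵥu_k‖_{L^p} ≤ C (‖ω_{k+1}‖_{L^p} + ‖ω_{k+2}‖_{L^p}) + εₙ`
  have hstep : ∀ n, eLpNorm (fun x => χ n x * fderiv ℝ u x v k) p volume ≤ C * S₁ + ε n := by
    intro n
    have hcR : 0 ≤ C₁ / R n := div_nonneg hC₁0 (hR n).le
    -- (a) `div wₙ = ⟪u, ∇χₙ⟫ = Dχₙ(u)`
    have hdiv_w : ∀ x, ‖VectorCalculus.divergence (w n) x‖ ≤ C₁ / R n * ‖U n x‖ := by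
      intro x
      have e1 : VectorCalculus.divergence (w n) x = ⟪u x, gradient (χ n) x⟫ := by
        show VectorCalculus.divergence (fun y => χ n y • u y) x = _
        rw [divergence_smul_apply (hχdiff n x) (hud x), hdiv x, mul_zero, zero_add]
      rw [e1]
      calc ‖⟪u x, gradient (χ n) x⟫‖ ≤ ‖u x‖ * ‖gradient (χ n) x‖ := norm_inner_le_norm _ _
        _ = ‖(fderiv ℝ (χ n) x).smulRight (u x)‖ := by
            rw [norm_gradient_eq_row, norm_smulRight_apply, mul_comm]
        _ ≤ C₁ / R n * ‖U n x‖ := hT n x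
    -- (b) `(curl wₙ)_j = χₙ (curl u)_j + (curlCLM (∇χₙ ⊗ u))_j`
    have hcurl_w : ∀ j x, ‖curl (w n) x j‖ ≤ ‖curl u x j‖ + ‖curlCLM‖ * (C₁ / R n) * ‖U n x‖ := by
      intro j x
      have e1 : curl (w n) x = χ n x • curl u x +
          curlCLM ((fderiv ℝ (χ n) x).smulRight (u x)) := by
        show curl (fun y => χ n y • u y) x = _
        exact curl_smul (hχdiff n x) (hud x)
      have e2 : curl (w n) x j = χ n x * curl u x j +
          curlCLM ((fderiv ℝ (χ n) x).smulRight (u x)) j := by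
        rw [e1]; rfl
      rw [e2]
      calc ‖χ n x * curl u x j + curlCLM ((fderiv ℝ (χ n) x).smulRight (u x)) j‖
          ≤ ‖χ n x * curl u x j‖ + ‖curlCLM ((fderiv ℝ (χ n) x).smulRight (u x)) j‖ :=
            norm_add_le _ _
        _ ≤ 1 * ‖curl u x j‖ + ‖curlCLM‖ * (C₁ / R n * ‖U n x‖) := by
            refine add_le_add ?_ ?_
            · rw [norm_mul, Real.norm_eq_abs]
              exact mul_le_mul_of_nonneg_right (hχ1 n x) (norm_nonneg _)
            · calc ‖curlCLM ((fderiv ℝ (χ n) x).smulRight (u x)) j‖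
                  ≤ ‖curlCLM ((fderiv ℝ (χ n) x).smulRight (u x))‖ := by
                    rw [Real.norm_eq_abs]; exact abs_apply_le_norm_row _ _
                _ ≤ ‖curlCLM‖ * ‖(fderiv ℝ (χ n) x).smulRight (u x)‖ := le_opNorm _ _
                _ ≤ ‖curlCLM‖ * (C₁ / R n * ‖U n x‖) :=
                    mul_le_mul_of_nonneg_left (hT n x) (norm_nonneg curlCLM)
        _ = ‖curl u x j‖ + ‖curlCLM‖ * (C₁ / R n) * ‖U n x‖ := by ring
    -- (c) `χₙ ∂ᵥu_k = ∂ᵥ(wₙ)_k − (∂ᵥχₙ) u_k`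
    have hχDu : ∀ x, ‖χ n x * fderiv ℝ u x v k‖ ≤
        ‖fderiv ℝ (w n) x v k‖ + C₁ / R n * ‖U n x‖ := by
      intro x
      have e1 : χ n x * fderiv ℝ u x v k =
          fderiv ℝ (w n) x v k - fderiv ℝ (χ n) x v * u x k := by
        rw [show fderiv ℝ (w n) x = fderiv ℝ (fun y => χ n y • u y) x from rfl,
          fderiv_fun_smul (hχdiff n x) (hud x)]
        simp only [FunLike.coe_add, FunLike.coe_smul, Pi.add_apply,
          Pi.smul_apply, ContinuousLinearMap.smulRight_apply, PiLp.add_apply, PiLp.smul_apply,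
          smul_eq_mul]
        ring
      rw [e1]
      refine (norm_sub_le _ _).trans (add_le_add le_rfl ?_)
      calc ‖fderiv ℝ (χ n) x v * u x k‖ = |fderiv ℝ (χ n) x v| * |u x k| := by
            rw [norm_mul, Real.norm_eq_abs, Real.norm_eq_abs]
        _ ≤ (‖fderiv ℝ (χ n) x‖ * ‖v‖) * ‖u x‖ := by
            refine mul_le_mul ?_ (abs_apply_le_norm_row _ _) (abs_nonneg _) (by positivity)
            rw [← Real.norm_eq_abs]; exact le_opNorm _ _
        _ ≤ ‖fderiv ℝ (χ n) x‖ * 1 * ‖u x‖ := by gcongr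
        _ = ‖(fderiv ℝ (χ n) x).smulRight (u x)‖ := by rw [mul_one, norm_smulRight_apply]
        _ ≤ C₁ / R n * ‖U n x‖ := hT n x
    -- measurability
    have mDw : AEStronglyMeasurable (fun x => fderiv ℝ (w n) x v k) volume :=
      ((EuclideanSpace.proj k).continuous.comp
        (((hwd n).continuous_fderiv (by simp)).clm_apply continuous_const)).aestronglyMeasurable
    have mcurl : ∀ j, AEStronglyMeasurable (fun x => curl u x j) volume := fun j =>
      (hcurljc j).aestronglyMeasurable
    -- `L^p` bounds
    have h1 : eLpNorm (fun x => χ n x * fderiv ℝ u x v k) p volume ≤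
        eLpNorm (fun x => fderiv ℝ (w n) x v k) p volume +
          ENNReal.ofReal (C₁ / R n) * eLpNorm (U n) p volume :=
      eLpNorm_le_of_norm_le_add_mul_row hcR mDw (mU n) hp1' hχDu
    have h2 : eLpNorm (fun x => fderiv ℝ (w n) x v k) p volume ≤
        C * (eLpNorm (fun x => curl (w n) x (k + 1)) p volume +
          eLpNorm (fun x => curl (w n) x (k + 2)) p volume +
          eLpNorm (VectorCalculus.divergence (w n)) p volume) :=
      hC (w n) (hwd n) (hwc n) v hv k
    have h3 : ∀ j, eLpNorm (fun x => curl (w n) x j) p volume ≤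
        eLpNorm (fun x => curl u x j) p volume +
          ENNReal.ofReal (‖curlCLM‖ * (C₁ / R n)) * eLpNorm (U n) p volume := fun j =>
      eLpNorm_le_of_norm_le_add_mul_row (by positivity) (mcurl j) (mU n) hp1' (hcurl_w j)
    have h4 : eLpNorm (VectorCalculus.divergence (w n)) p volume ≤
        ENNReal.ofReal (C₁ / R n) * eLpNorm (U n) p volume := by
      have h := eLpNorm_le_of_norm_le_add_mul_row (f := VectorCalculus.divergence (w n))
        (g := fun _ : EuclideanSpace ℝ (Fin 3) => (0 : ℝ)) hcR aestronglyMeasurable_const (mU n) hp1'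
        (fun x => by rw [norm_zero, zero_add]; exact hdiv_w x)
      have h0 : eLpNorm (fun _ : EuclideanSpace ℝ (Fin 3) => (0 : ℝ)) p volume = 0 := eLpNorm_zero
      rw [h0, zero_add] at h
      exact h
    have h3' : ENNReal.ofReal (‖curlCLM‖ * (C₁ / R n)) * eLpNorm (U n) p volume =
        ENNReal.ofReal ‖curlCLM‖ * (ENNReal.ofReal (C₁ / R n) * eLpNorm (U n) p volume) := by
      rw [ENNReal.ofReal_mul (norm_nonneg curlCLM), mul_assoc]
    set Q : ℝ≥0∞ := ENNReal.ofReal (C₁ / R n) * eLpNorm (U n) p volume with hQdef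
    calc eLpNorm (fun x => χ n x * fderiv ℝ u x v k) p volume
        ≤ eLpNorm (fun x => fderiv ℝ (w n) x v k) p volume + Q := h1
      _ ≤ C * (eLpNorm (fun x => curl (w n) x (k + 1)) p volume +
            eLpNorm (fun x => curl (w n) x (k + 2)) p volume +
            eLpNorm (VectorCalculus.divergence (w n)) p volume) + Q := by gcongr
      _ ≤ C * ((eLpNorm (fun x => curl u x (k + 1)) p volume + ENNReal.ofReal ‖curlCLM‖ * Q) +
            (eLpNorm (fun x => curl u x (k + 2)) p volume + ENNReal.ofReal ‖curlCLM‖ * Q) + Q) +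
            Q := by
          rw [← h3']
          gcongr
          · exact h3 (k + 1)
          · exact h3 (k + 2)
      _ = C * S₁ +
          ((C : ℝ≥0∞) * (ENNReal.ofReal ‖curlCLM‖ + ENNReal.ofReal ‖curlCLM‖ + 1) + 1) * Q := by
          rw [hS₁]; ring
      _ ≤ C * S₁ + ε n := add_le_add le_rfl (mul_le_mul' le_rfl (hQ n))
  -- Step 2: `εₙ → 0` (`δₙ = C₁ 2^{3e} Rₙ^{3e-1} → 0` since `3e < 1`, and `M < ∞`)
  have hδt : Tendsto δ atTop (𝓝 0) := by
    have hδ' : ∀ n, δ n = C₁ * (2 : ℝ) ^ (3 * e) * (R n) ^ (3 * e - 1) := by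
      intro n
      have hR0 : 0 ≤ R n := (hR n).le
      show C₁ / R n * ((2 * R n) ^ 3) ^ e = _
      rw [show ((2 * R n) ^ 3 : ℝ) = (2 * R n) ^ (3 : ℝ) by norm_cast, ← Real.rpow_mul (by positivity),
        Real.mul_rpow (by norm_num) hR0, Real.rpow_sub_one (hR n).ne']
      field_simp
    rw [show δ = fun n => C₁ * (2 : ℝ) ^ (3 * e) * (R n) ^ (3 * e - 1) from funext hδ']
    have hRt : Tendsto R atTop atTop := by
      rw [hRdef]
      exact tendsto_natCast_atTop_atTop.atTop_add tendsto_const_nhds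
    have hpow : Tendsto (fun n => (R n) ^ (3 * e - 1)) atTop (𝓝 0) := by
      have hneg : 0 < -(3 * e - 1) := by rw [hedef] at *; linarith
      have h := (tendsto_rpow_neg_atTop hneg).comp hRt
      rw [neg_neg] at h
      exact h
    simpa using hpow.const_mul (C₁ * (2 : ℝ) ^ (3 * e))
  have hεt : Tendsto ε atTop (𝓝 0) := by
    have h0 : Tendsto (fun n => ENNReal.ofReal (δ n)) atTop (𝓝 0) := by
      rw [← ENNReal.ofReal_zero]
      exact ENNReal.tendsto_ofReal hδt
    have h1 : Tendsto (fun n => ENNReal.ofReal (δ n) * M) atTop (𝓝 0) := by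
      simpa using ENNReal.Tendsto.mul_const h0 (Or.inr hMt.ne)
    have hKt : ((C : ℝ≥0∞) * (ENNReal.ofReal ‖curlCLM‖ + ENNReal.ofReal ‖curlCLM‖ + 1) + 1) ≠ ⊤ := by
      finiteness
    simpa [hε] using ENNReal.Tendsto.const_mul h1 (Or.inr hKt)
  -- Step 3: Fatou in `L^p` along `χₙ ∂ᵥu_k → ∂ᵥu_k`
  have hlim : ∀ x, Tendsto (fun n => χ n x * fderiv ℝ u x v k) atTop
      (𝓝 (fderiv ℝ u x v k)) := fun x => by
    have h := (tendsto_cutoff_natCast_add_one x).mul_const (fderiv ℝ u x v k)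
    rwa [one_mul] at h
  have hmeas : ∀ n, AEStronglyMeasurable (fun x => χ n x * fderiv ℝ u x v k) volume := fun n =>
    (((hχd n).continuous).mul hentry).aestronglyMeasurable
  have hFatou : eLpNorm (fun x => fderiv ℝ u x v k) p volume ≤
      liminf (fun n => eLpNorm (fun x => χ n x * fderiv ℝ u x v k) p volume) atTop :=
    MeasureTheory.Lp.eLpNorm_lim_le_liminf_eLpNorm hmeas (fun x => fderiv ℝ u x v k)
      (Eventually.of_forall hlim)
  have hB' : Tendsto (fun n => (C : ℝ≥0∞) * S₁ + ε n) atTop (𝓝 ((C : ℝ≥0∞) * S₁)) := by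
    simpa using tendsto_const_nhds.add hεt
  calc eLpNorm (fun x => fderiv ℝ u x v k) p volume
      ≤ liminf (fun n => eLpNorm (fun x => χ n x * fderiv ℝ u x v k) p volume) atTop := hFatou
    _ ≤ liminf (fun n => (C : ℝ≥0∞) * S₁ + ε n) atTop :=
        liminf_le_liminf (Eventually.of_forall hstep)
    _ = C * S₁ := hB'.liminf_eq

end RowEstimate

end Literature.Analysis.FluidPDE
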